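import Mathlib
import Literature.NumberTheory.Transcendental.KZRayDilog
import Literature.NumberTheory.Transcendental.KZIdealTetrahedron
import Literature.NumberTheory.Transcendental.KZCalculusProofs
import Literature.NumberTheory.Transcendental.KZLogCalculusProofs
import Literature.NumberTheory.Transcendental.BlochWignerIdealTetrahedronVolume
import Literature.NumberTheory.Transcendental.SemialgebraicMapsProofs
import Literature.NumberTheory.Transcendental.KZSemialgebraicComplex

/-!
# `OffTetraSectorKernel`, line `flat-shadow`: the Möbius cell (rule 2 + sign rule)

Stub `stub_mobiusCell` of the crux `OffTetraSectorKernel` (stmt-KontsevichZagierPeriods-10557, route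
HyperbolicBloch): the last station of the Milnor bridge, Part M of the tree's analytic proof
`BlochWigner_idealTetrahedronVolume_holds` (`setIntegral_invG_eq_zero`) re-read as ONE change-of-variables
move. Coordinates `w 0 = s`, `w 1 = v`; `z = a + ib` algebraic, `b > 0`, `c = |z|² − 2a`,
`Q(s) = (1 − sa)² + (sb)²`, `f = b/(2 Q(s) v)`, `g(s) = s(1 + cs)/(1 − s)`. The `G`-cell
`G = [{0 < s < 1, v strictly between 1 and g(s)}, sgn(v − 1)·f]` is a RELATION: with `G₊ = G ∩ {v > 1}`,
`G₋ = G ∩ {v < 1}`, the Möbius involution `Θ(s, v) = (m(s), 1/v)`, `m(s) = (1 − s)/(1 + cs)` (tree: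
`IdealTetrahedronVolume.mob`, `mob_mob`, `quad_mob`, `arg_mob` = "`g(m(s)) = 1/g(s)`", `hasDerivAt_mob`)
maps `G₊` bijectively onto `G₋` with `|det Θ′| = (1 + c)/((1 + cs)² v²)` and `f ∘ Θ · |det Θ′| = f`
(`Q(m(s)) = (1 + c) Q(s)/(1 + cs)²`), so `[G₊, f] − [G₋, f] ∈ changeOfVariablesRel`; and
`[G] − [G₊, f] − [G₋, −f] ∈ domainAddRel`, `[G₋, −f] + [G₋, f] ∈ relations`.

References: M. Kontsevich, D. Zagier, *Periods* (2001), §1.2 rule (2); J. L. Dupont, *Scissors congruences,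
group homology and characteristic classes* (2001), Ch. 10 (10.9); D. Zagier, *The dilogarithm function*
(2007), Ch. I §3.
-/

noncomputable section

open Set MeasureTheory MvPolynomial
open Literature.NumberTheory.Transcendental Literature.ModelTheory.ExponentialFields
open Literature.NumberTheory.Transcendental.IdealTetrahedronVolume (mob mob_mob quad_mob arg_mob hasDerivAt_mob
  one_add_c_pos one_add_c_mul_pos)

namespace Summit.KontsevichZagierPeriods.HyperbolicBloch.OffTetraSectorKernel

variable {z : ℂ}

/-! ## The constant `c = |z|² − 2 Re z` -/

/-- `c = |z|² − 2a = a² + b² − 2a`. [folklore] -/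
theorem mobCell_c_eq (z : ℂ) : Complex.normSq z - 2 * z.re = z.re ^ 2 + z.im ^ 2 - 2 * z.re := by
  rw [Complex.normSq_apply]; ring

/-- `1 + c > 0`. [folklore] -/
theorem mobCell_one_add_c_pos (him : 0 < z.im) : 0 < 1 + (Complex.normSq z - 2 * z.re) := by
  rw [mobCell_c_eq]; exact one_add_c_pos z.re him

/-- `1 + cs > 0` for `0 ≤ s ≤ 1`. [folklore] -/
theorem mobCell_one_add_c_mul_pos (him : 0 < z.im) {s : ℝ} (h0 : 0 ≤ s) (h1 : s ≤ 1) :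
    0 < 1 + (Complex.normSq z - 2 * z.re) * s := by
  rw [mobCell_c_eq]; exact one_add_c_mul_pos z.re him h0 h1

/-- `Q(s) = 1 − 2as + (c + 2a)s²`. [folklore] -/
theorem mobCell_Q_eq (z : ℂ) (s : ℝ) : (1 - s * z.re) ^ 2 + (s * z.im) ^ 2 =
    1 - 2 * z.re * s + ((Complex.normSq z - 2 * z.re) + 2 * z.re) * s ^ 2 := by
  rw [Complex.normSq_apply]; ring

/-- `m` maps `(0, 1)` into `(0, 1)`. [folklore] -/
theorem mobCell_mob_mem (him : 0 < z.im) {s : ℝ} (hs : s ∈ Ioo (0 : ℝ) 1) :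
    mob (Complex.normSq z - 2 * z.re) s ∈ Ioo (0 : ℝ) 1 := by
  have h1 := mobCell_one_add_c_mul_pos him hs.1.le hs.2.le
  refine ⟨div_pos (by linarith [hs.2]) h1, ?_⟩
  rw [mob, div_lt_one h1]
  nlinarith [mul_pos hs.1 (mobCell_one_add_c_pos him)]


/-! ## The involution `Θ(s, v) = (m(s), 1/v)` -/

/-- Coordinates of `Θ`. [folklore] -/
theorem mobCell_theta_apply {c : ℝ} (Θ : (Fin 2 → ℝ) → (Fin 2 → ℝ))
    (hΘ : ∀ w, Θ w = ![(1 - w 0) / (1 + c * w 0), (w 1)⁻¹]) (w : Fin 2 → ℝ) :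
    Θ w 0 = mob c (w 0) ∧ Θ w 1 = (w 1)⁻¹ := by
  rw [hΘ w]; exact ⟨rfl, rfl⟩

/-- `Θ` is an involution (where `1 + cs ≠ 0`, `1 + c ≠ 0`). [folklore] -/
theorem mobCell_theta_theta {c : ℝ} (Θ : (Fin 2 → ℝ) → (Fin 2 → ℝ))
    (hΘ : ∀ w, Θ w = ![(1 - w 0) / (1 + c * w 0), (w 1)⁻¹]) {w : Fin 2 → ℝ} (h : 1 + c * w 0 ≠ 0)
    (hK : 1 + c ≠ 0) : Θ (Θ w) = w := by
  obtain ⟨e0, e1⟩ := mobCell_theta_apply Θ hΘ (Θ w)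
  obtain ⟨f0, f1⟩ := mobCell_theta_apply Θ hΘ w
  funext i
  fin_cases i
  · show Θ (Θ w) 0 = w 0
    rw [e0, f0, mob_mob h hK]
  · show Θ (Θ w) 1 = w 1
    rw [e1, f1, inv_inv]

/-- **The derivative of `Θ` and its determinant**: at a point with `1 + cs ≠ 0`, `v ≠ 0`, `Θ` has the
Fréchet derivative `diag(m′(s), −1/v²)`, `m′(s) = −(1 + c)/(1 + cs)²`. [folklore] -/
theorem mobCell_theta_hasFDerivAt_det {c : ℝ} (Θ : (Fin 2 → ℝ) → (Fin 2 → ℝ))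
    (hΘ : ∀ w, Θ w = ![(1 - w 0) / (1 + c * w 0), (w 1)⁻¹]) {w : Fin 2 → ℝ} (h : 1 + c * w 0 ≠ 0)
    (hv : w 1 ≠ 0) :
    ∃ L : (Fin 2 → ℝ) →L[ℝ] (Fin 2 → ℝ), HasFDerivAt Θ L w ∧
      L.det = (-(1 + c) / (1 + c * w 0) ^ 2) * (-(w 1 ^ 2)⁻¹) := by
  set M : Matrix (Fin 2) (Fin 2) ℝ := !![-(1 + c) / (1 + c * w 0) ^ 2, 0; 0, -(w 1 ^ 2)⁻¹] with hM
  refine ⟨LinearMap.toContinuousLinearMap (Matrix.toLin' M), ?_, ?_⟩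
  · have h0 : HasFDerivAt (fun x => Θ x 0)
        ((ContinuousLinearMap.proj 0).comp (LinearMap.toContinuousLinearMap (Matrix.toLin' M))) w := by
      have hf : (fun x => Θ x 0) = (mob c) ∘ fun x : Fin 2 → ℝ => x 0 := by
        funext x; exact (mobCell_theta_apply Θ hΘ x).1
      rw [hf]
      refine ((hasDerivAt_mob h).comp_hasFDerivAt w (hasFDerivAt_apply (𝕜 := ℝ) (0 : Fin 2) w)).congr_fderiv ?_
      ext u
      simp [hM, Matrix.toLin'_apply, dotProduct, Fin.sum_univ_two]
    have h1 : HasFDerivAt (fun x => Θ x 1)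
        ((ContinuousLinearMap.proj 1).comp (LinearMap.toContinuousLinearMap (Matrix.toLin' M))) w := by
      have hf : (fun x => Θ x 1) = (fun y : ℝ => y⁻¹) ∘ fun x : Fin 2 → ℝ => x 1 := by
        funext x; exact (mobCell_theta_apply Θ hΘ x).2
      rw [hf]
      refine ((hasDerivAt_inv hv).comp_hasFDerivAt w (hasFDerivAt_apply (𝕜 := ℝ) (1 : Fin 2) w)).congr_fderiv ?_
      ext u
      simp [hM, Matrix.toLin'_apply, dotProduct, Fin.sum_univ_two]
    refine hasFDerivAt_pi'' fun i => ?_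
    fin_cases i
    exacts [h0, h1]
  · rw [LinearMap.det_toContinuousLinearMap, LinearMap.det_toLin', Matrix.det_fin_two_of]
    ring


/-! ## The Möbius cell is a relation -/

/-- **The Möbius cell, explicit form.** [cite: Dupont2001, Ch. 10 (10.9)] -/
theorem mobiusCell_core (hz : IsAlgebraic ℚ z) (him : 0 < z.im) (G : KZ.IntegralRep 2)
    (hG : G.domain = {w | 0 < w 0 ∧ w 0 < 1 ∧ ((1 < w 1 ∧ w 1 * (1 - w 0) < w 0 * (1 + (Complex.normSq z - 2 * z.re) * w 0)) ∨
      (w 0 * (1 + (Complex.normSq z - 2 * z.re) * w 0) < w 1 * (1 - w 0) ∧ w 1 < 1))})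
    (hGi : EqOn G.integrand (fun w => (if 1 < w 1 then (1 : ℝ) else -1) * z.im /
      (2 * ((1 - w 0 * z.re) ^ 2 + (w 0 * z.im) ^ 2) * w 1)) G.domain) :
    KZ.of G ∈ KZ.relations := by
  set c := Complex.normSq z - 2 * z.re with hc
  set Gp : Set (Fin 2 → ℝ) := {w | 0 < w 0 ∧ w 0 < 1 ∧ 1 < w 1 ∧ w 1 * (1 - w 0) < w 0 * (1 + c * w 0)}
    with hGp
  set Gm : Set (Fin 2 → ℝ) := {w | 0 < w 0 ∧ w 0 < 1 ∧ w 0 * (1 + c * w 0) < w 1 * (1 - w 0) ∧ w 1 < 1}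
    with hGm
  have hK : 0 < 1 + c := mobCell_one_add_c_pos him
  have hcs : ∀ {s : ℝ}, 0 < s → s < 1 → 0 < 1 + c * s := fun h0 h1 =>
    mobCell_one_add_c_mul_pos him h0.le h1.le
  have hQ : ∀ s : ℝ, 0 < (1 - s * z.re) ^ 2 + (s * z.im) ^ 2 := fun s => KZ.rayDilog_den_pos him.ne' z.re s
  -- the splitting of the domain
  have hsplit : G.domain = Gp ∪ Gm := by
    rw [hG, hGp, hGm]; ext w; simp only [mem_setOf_eq, mem_union]; tauto
  have hdisj : Disjoint Gp Gm := disjoint_left.2 fun w h1 h2 => lt_asymm h1.2.2.1 h2.2.2.2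
  -- semialgebraicity
  obtain ⟨hre, him'⟩ := isAlgebraic_re_im hz
  have hU : IsSemialgebraic ℚ (univ : Set (Fin 2 → ℝ)) := isSemialgebraic_univ
  have hcalg : IsAlgebraic ℚ c := by
    have hN : IsAlgebraic ℚ (Complex.normSq z) := by
      rw [Complex.normSq_apply]; exact (hre.mul hre).add (him'.mul him')
    rw [hc, two_mul]; exact hN.sub (hre.add hre)
  have s0 : IsSemialgebraicFunOn ℚ (univ : Set (Fin 2 → ℝ)) (fun w => w 0) :=
    (isSemialgebraicFunOn_aeval hU (X 0)).congr fun w _ => by simp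
  have s1 : IsSemialgebraicFunOn ℚ (univ : Set (Fin 2 → ℝ)) (fun w => w 1) :=
    (isSemialgebraicFunOn_aeval hU (X 1)).congr fun w _ => by simp
  have sone : IsSemialgebraicFunOn ℚ (univ : Set (Fin 2 → ℝ)) (fun _ => (1 : ℝ)) := by
    simpa using isSemialgebraicFunOn_natCast (k := ℚ) (R := ℝ) hU 1
  have szero : IsSemialgebraicFunOn ℚ (univ : Set (Fin 2 → ℝ)) (fun _ => (0 : ℝ)) := by
    simpa using isSemialgebraicFunOn_natCast (k := ℚ) (R := ℝ) hU 0
  have scc : IsSemialgebraicFunOn ℚ (univ : Set (Fin 2 → ℝ)) (fun _ => c) :=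
    isSemialgebraicFunOn_const_of_isAlgebraic hU hcalg
  have sA : IsSemialgebraicFunOn ℚ (univ : Set (Fin 2 → ℝ)) (fun w => w 1 * (1 - w 0)) :=
    IsSemialgebraicFunOn.mul_holds s1 (IsSemialgebraicFunOn.sub_holds sone s0)
  have sB : IsSemialgebraicFunOn ℚ (univ : Set (Fin 2 → ℝ)) (fun w => w 0 * (1 + c * w 0)) :=
    IsSemialgebraicFunOn.mul_holds s0 (IsSemialgebraicFunOn.add_holds sone (IsSemialgebraicFunOn.mul_holds scc s0))
  have hGpsa : IsSemialgebraic ℚ Gp :=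
    (isSemialgebraic_setOf_lt_of_isSemialgebraicFunOn szero s0).inter
      ((isSemialgebraic_setOf_lt_of_isSemialgebraicFunOn s0 sone).inter
        ((isSemialgebraic_setOf_lt_of_isSemialgebraicFunOn sone s1).inter
          (isSemialgebraic_setOf_lt_of_isSemialgebraicFunOn sA sB)))
  have hGmsa : IsSemialgebraic ℚ Gm :=
    (isSemialgebraic_setOf_lt_of_isSemialgebraicFunOn szero s0).inter
      ((isSemialgebraic_setOf_lt_of_isSemialgebraicFunOn s0 sone).inter
        ((isSemialgebraic_setOf_lt_of_isSemialgebraicFunOn sB sA).inter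
          (isSemialgebraic_setOf_lt_of_isSemialgebraicFunOn s1 sone)))
  -- the two pieces and the sign rule
  have hGpG : Gp ⊆ G.domain := by rw [hsplit]; exact subset_union_left
  have hGmG : Gm ⊆ G.domain := by rw [hsplit]; exact subset_union_right
  set rp := G.restrict Gp hGpsa hGpG with hrp
  set rm := G.restrict Gm hGmsa hGmG with hrm
  have e1 : KZ.of G - KZ.of rp - KZ.of rm ∈ KZ.relations :=
    KZ.domainAddRel_subset_relations ⟨2, G, rp, rm, hsplit, by
      rw [show rp.domain ∩ rm.domain = Gp ∩ Gm from rfl, hdisj.inter_eq, measure_empty],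
      fun _ _ => rfl, fun _ _ => rfl, rfl⟩
  have e2 : KZ.of rm + KZ.of rm.neg ∈ KZ.relations :=
    KZ.of_add_of_mem_relations_of_eqOn_neg rfl fun _ _ => rfl
  -- the Möbius involution
  obtain ⟨Θ, hΘ⟩ : ∃ Θ : (Fin 2 → ℝ) → (Fin 2 → ℝ), ∀ w, Θ w = ![(1 - w 0) / (1 + c * w 0), (w 1)⁻¹] :=
    ⟨_, fun _ => rfl⟩
  have hΘ0 : ∀ w, Θ w 0 = mob c (w 0) := fun w => (mobCell_theta_apply Θ hΘ w).1
  have hΘ1 : ∀ w, Θ w 1 = (w 1)⁻¹ := fun w => (mobCell_theta_apply Θ hΘ w).2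
  -- `g(m(s)) = 1/g(s)` in the form used below
  have hg : ∀ {s : ℝ}, 0 < s → s < 1 → mob c s * (1 + c * mob c s) =
      (1 - mob c s) * (s * (1 + c * s) / (1 - s))⁻¹ := fun {s} h0 h1 => by
    have hm := mobCell_mob_mem him (z := z) ⟨h0, h1⟩
    have e := arg_mob (hcs h0 h1).ne' hK.ne' h0.ne' (by linarith : (1 : ℝ) - s ≠ 0)
    rw [div_eq_iff (by linarith [hm.2] : (1 : ℝ) - mob c s ≠ 0)] at e
    linarith [e]
  -- `Θ` maps `G₊` into `G₋` and `G₋` into `G₊`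
  have hmaps : ∀ w ∈ Gp, Θ w ∈ Gm := by
    rintro w ⟨h0, h1, hv, hlt⟩
    have hm := mobCell_mob_mem him (z := z) ⟨h0, h1⟩
    have hs1 : 0 < 1 - w 0 := by linarith
    have hgs : 0 < w 0 * (1 + c * w 0) / (1 - w 0) := div_pos (mul_pos h0 (hcs h0 h1)) hs1
    refine ⟨by rw [hΘ0]; exact hm.1, by rw [hΘ0]; exact hm.2, ?_, by rw [hΘ1]; exact inv_lt_one_of_one_lt₀ hv⟩
    rw [hΘ0, hΘ1, hg h0 h1, mul_comm ((w 1)⁻¹)]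
    refine mul_lt_mul_of_pos_left ?_ (by linarith [hm.2])
    rw [inv_lt_inv₀ hgs (zero_lt_one.trans hv), lt_div_iff₀ hs1]
    exact hlt
  have hmaps' : ∀ w ∈ Gm, Θ w ∈ Gp := by
    rintro w ⟨h0, h1, hlt, hv⟩
    have hm := mobCell_mob_mem him (z := z) ⟨h0, h1⟩
    have hs1 : 0 < 1 - w 0 := by linarith
    have hgs : 0 < w 0 * (1 + c * w 0) / (1 - w 0) := div_pos (mul_pos h0 (hcs h0 h1)) hs1
    have hvpos : 0 < w 1 := by
      by_contra hle
      push Not at hle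
      have : w 1 * (1 - w 0) ≤ 0 := mul_nonpos_of_nonpos_of_nonneg hle hs1.le
      linarith [mul_pos h0 (hcs h0 h1)]
    refine ⟨by rw [hΘ0]; exact hm.1, by rw [hΘ0]; exact hm.2, by rw [hΘ1]; exact one_lt_inv₀ hvpos |>.2 hv, ?_⟩
    rw [hΘ0, hΘ1, hg h0 h1, mul_comm ((w 1)⁻¹)]
    refine mul_lt_mul_of_pos_left ?_ (by linarith [hm.2])
    rw [inv_lt_inv₀ hvpos hgs, div_lt_iff₀ hs1]
    exact hlt
  have hinv : ∀ w ∈ Gp ∪ Gm, Θ (Θ w) = w := by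
    rintro w (⟨h0, h1, -, -⟩ | ⟨h0, h1, -, -⟩) <;>
      exact mobCell_theta_theta Θ hΘ (hcs h0 h1).ne' hK.ne'
  have himage : Θ '' Gp = Gm := by
    refine Subset.antisymm ?_ fun u hu => ⟨Θ u, hmaps' u hu, hinv u (Or.inr hu)⟩
    rintro _ ⟨w, hw, rfl⟩
    exact hmaps w hw
  have hinj : InjOn Θ Gp := fun u hu w hw huw => by
    rw [← hinv u (Or.inl hu), ← hinv w (Or.inl hw), huw]
  -- semialgebraicity of `Θ` on `G₊`
  have hΘsa : IsSemialgebraicMapOn ℚ Gp Θ := by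
    refine IsSemialgebraicMapOn.of_forall hGpsa fun j => ?_
    have s0' := s0.mono (subset_univ _) hGpsa
    have s1' := s1.mono (subset_univ _) hGpsa
    have sone' := sone.mono (subset_univ _) hGpsa
    have scc' := scc.mono (subset_univ _) hGpsa
    fin_cases j
    · refine (IsSemialgebraicFunOn.div (IsSemialgebraicFunOn.sub_holds sone' s0')
        (IsSemialgebraicFunOn.add_holds sone' (IsSemialgebraicFunOn.mul_holds scc' s0'))
        fun w hw => (hcs hw.1 hw.2.1).ne').congr fun w _ => ?_
      simp [hΘ]
    · refine (s1'.inv fun w hw => (zero_lt_one.trans hw.2.2.1).ne').congr fun w _ => ?_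
      simp [hΘ]
  -- the derivative within `G₊` and the Jacobian identity
  have hex : ∀ x : Fin 2 → ℝ, ∃ L : (Fin 2 → ℝ) →L[ℝ] (Fin 2 → ℝ), (1 + c * x 0 ≠ 0 ∧ x 1 ≠ 0) →
      HasFDerivAt Θ L x ∧ L.det = (-(1 + c) / (1 + c * x 0) ^ 2) * (-(x 1 ^ 2)⁻¹) := by
    intro x
    by_cases hx : 1 + c * x 0 ≠ 0 ∧ x 1 ≠ 0
    · obtain ⟨L, hL, hdet⟩ := mobCell_theta_hasFDerivAt_det Θ hΘ hx.1 hx.2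
      exact ⟨L, fun _ => ⟨hL, hdet⟩⟩
    · exact ⟨0, fun h => (hx h).elim⟩
  choose Θ' hΘ' using hex
  have hf : ∀ s v : ℝ, 0 < s → s < 1 → v ≠ 0 →
      z.im / (2 * ((1 - mob c s * z.re) ^ 2 + (mob c s * z.im) ^ 2) * v⁻¹) *
        |(-(1 + c) / (1 + c * s) ^ 2) * (-(v ^ 2)⁻¹)| =
      z.im / (2 * ((1 - s * z.re) ^ 2 + (s * z.im) ^ 2) * v) := by
    intro s v h0 h1 hv
    have hp := hcs h0 h1
    have hQs := hQ s
    rw [mobCell_Q_eq z (mob c s), ← hc, quad_mob hp.ne', ← mobCell_Q_eq z s,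
      show |(-(1 + c) / (1 + c * s) ^ 2) * (-(v ^ 2)⁻¹)| = (1 + c) / ((1 + c * s) ^ 2 * v ^ 2) by
        rw [neg_div, neg_mul_neg, abs_of_pos (mul_pos (div_pos hK (pow_pos hp 2)) (inv_pos.2 (by positivity)))]
        field_simp]
    field_simp
  have e3 : KZ.of rp - KZ.of rm.neg ∈ KZ.relations := by
    refine KZ.changeOfVariablesRel_subset_relations ⟨2, rp, rm.neg, Θ, Θ', hΘsa, fun x hx => ?_, hinj,
      ?_, fun x hx => ?_, rfl⟩
    · exact ((hΘ' x ⟨(hcs hx.1 hx.2.1).ne', (zero_lt_one.trans hx.2.2.1).ne'⟩).1).hasFDerivWithinAt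
    · exact himage.symm
    · have hx' : x ∈ Gp := hx
      obtain ⟨h0, h1, hv, -⟩ := hx
      have hΘx : Θ x ∈ Gm := hmaps x hx'
      rw [(hΘ' x ⟨(hcs h0 h1).ne', (zero_lt_one.trans hv).ne'⟩).2]
      show G.integrand x = -G.integrand (Θ x) * _
      rw [hGi (hGpG hx'), hGi (hGmG hΘx)]
      have hx1 : ¬ (1 : ℝ) < (x 1)⁻¹ := not_lt.2 (inv_le_one_of_one_le₀ hv.le)
      simp only [if_pos hv, one_mul, hΘ0, hΘ1, if_neg hx1]
      rw [show -((-1) * z.im / (2 * ((1 - mob c (x 0) * z.re) ^ 2 + (mob c (x 0) * z.im) ^ 2) * (x 1)⁻¹)) =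
        z.im / (2 * ((1 - mob c (x 0) * z.re) ^ 2 + (mob c (x 0) * z.im) ^ 2) * (x 1)⁻¹) by ring]
      exact (hf (x 0) (x 1) h0 h1 (zero_lt_one.trans hv).ne').symm
  have : KZ.of G = (KZ.of G - KZ.of rp - KZ.of rm) + (KZ.of rp - KZ.of rm.neg) + (KZ.of rm + KZ.of rm.neg) := by
    abel
  rw [this]
  exact add_mem (add_mem e1 e3) e2

/-- **STUB `stub_mobiusCell`** (Möbius cell, rule 2 + sign rule): for algebraic `z` with `Im z > 0` every
`G`-cell representation is a relation (`mobiusCell_core`). [cite: Dupont2001, Ch. 10 (10.9)] -/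
theorem stub_mobiusCell : ∀ z : ℂ, IsAlgebraic ℚ z → 0 < z.im → ∀ G : Literature.NumberTheory.Transcendental.KZ.IntegralRep 2, G.domain = {w | 0 < w 0 ∧ w 0 < 1 ∧ ((1 < w 1 ∧ w 1 * (1 - w 0) < w 0 * (1 + (Complex.normSq z - 2 * z.re) * w 0)) ∨ (w 0 * (1 + (Complex.normSq z - 2 * z.re) * w 0) < w 1 * (1 - w 0) ∧ w 1 < 1))} → Set.EqOn G.integrand (fun w => (if 1 < w 1 then (1 : ℝ) else -1) * z.im / (2 * ((1 - w 0 * z.re) ^ 2 + (w 0 * z.im) ^ 2) * w 1)) G.domain → Literature.NumberTheory.Transcendental.KZ.of G ∈ Literature.NumberTheory.Transcendental.KZ.relations :=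
  fun _ hz him G hG hGi => mobiusCell_core hz him G hG hGi

end Summit.KontsevichZagierPeriods.HyperbolicBloch.OffTetraSectorKernel

end
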